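import Mathlib
import HarnessLib
import Summits.HubbardSuperconductivity.HubbardSuperconductivity.Theorems.KLProgrammeKLRegimeSplitTwoLegSizesMSWithPiecesL
import Summits.HubbardSuperconductivity.HubbardSuperconductivity.Theorems.KLProgrammeKLRegimeSplitBundleV15

/-!
# Route `KLProgramme`, crux K3 — ENGINE child (stmt-…-19918 → gen-6 engine child, `stub_twoLeg_step` / `stub_twoLeg_scale0`,
# clause (E3a-MS)): GRADED ↔ TREE BOOKKEEPING for the fit discharge (piece sizes, slot `e`-family, Λ-budgets, the `msBarQ` budget)

Cell `gate-hubbard-kl`, seat hubbard-kl-k3c3-p3 (g4); MS-A34 / MS-A34-ter.  The graded fit lemmas (`…MSFitSlot*`, `…MSFitBase*`) speak of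
`x = 4^m`, `y = 4^{n₀}`; this module rewrites the tree's objects into that language: `pieceSize R U m j` at `j = 1 … 4`
(`pieceSize_one_eq … pieceSize_four_eq`), the certified high-part sizes `msE (4^{n₀}) (pieceSize R U m)` against the slot grading
(`msE_pieceSize_nonneg`, `msE_pieceSize_zero_le_jackson`, `msE_pieceSize_zero_le_contraction`, `two_pow_mul_msE_pieceSize_le`),
k3c3-p1's Λ-budgets `msA3L/msA4L` against the Λ-shapes (`msA3L_le_shape`, `msA4L_le_shape`), and the `Q.CE`-keyed budget
`msBarQ G Q U n₀ · pieceSize R U m j` in graded form (`msBarQ_mul_pieceSize_*`).  Pure bookkeeping; everything PROVED. [folklore]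
-/

noncomputable section

namespace Summit.HubbardSuperconductivity.HubbardSuperconductivity.Theorems.KLRegimeSplit

set_option linter.dupNamespace false -- summit = problem name (single-conjunct summit), D-0017

open Real Finset Summit.HubbardSuperconductivity.HubbardSuperconductivity.Theorems.PerturbedFermiCurve

/-! ## §1 Piece sizes in graded form -/

/-- `pieceSize R U m 1 = Gfr₁·U²/4^m`. -/
theorem pieceSize_one_eq (R : RenConsts) (U : ℝ) (m : ℕ) : pieceSize R U m 1 = R.Gfr 1 * U ^ 2 / (4 : ℝ) ^ m := by
  unfold pieceSize
  rw [uPow_succ, show (((1 : ℕ) : ℤ) - 2) * (m : ℤ) = -((m : ℕ) : ℤ) by push_cast; ring, zpow_neg, zpow_natCast]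
  ring

/-- `pieceSize R U m 2 = Gfr₂·U²`. -/
theorem pieceSize_two_eq (R : RenConsts) (U : ℝ) (m : ℕ) : pieceSize R U m 2 = R.Gfr 2 * U ^ 2 := by
  unfold pieceSize
  rw [uPow_succ, show (((2 : ℕ) : ℤ) - 2) * (m : ℤ) = 0 by push_cast; ring, zpow_zero, mul_one]

/-- `pieceSize R U m 3 = Gfr₃·U²·4^m`. -/
theorem pieceSize_three_eq (R : RenConsts) (U : ℝ) (m : ℕ) : pieceSize R U m 3 = R.Gfr 3 * U ^ 2 * (4 : ℝ) ^ m := by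
  unfold pieceSize
  rw [uPow_succ, show (((3 : ℕ) : ℤ) - 2) * (m : ℤ) = ((m : ℕ) : ℤ) by push_cast; ring, zpow_natCast]

/-- `pieceSize R U m 4 = Gfr₄·U²·(4^m)²`. -/
theorem pieceSize_four_eq (R : RenConsts) (U : ℝ) (m : ℕ) : pieceSize R U m 4 = R.Gfr 4 * U ^ 2 * ((4 : ℝ) ^ m) ^ 2 := by
  unfold pieceSize
  rw [uPow_succ, show (((4 : ℕ) : ℤ) - 2) * (m : ℤ) = ((2 * m : ℕ) : ℤ) by push_cast; ring, zpow_natCast, pow_mul']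

/-- `pieceSize R U m 0 = Gfr₀·|U|/(4^m)²`. -/
theorem pieceSize_zero_eq' (R : RenConsts) (U : ℝ) (m : ℕ) : pieceSize R U m 0 = R.Gfr 0 * |U| / ((4 : ℝ) ^ m) ^ 2 := by
  rw [pieceSize_zero_eq, show (16 : ℝ) = 4 ^ 2 by norm_num, ← pow_mul, pow_mul']
  ring

/-- `16^n = (4^n)²`. -/
theorem sixteen_pow_eq_four_sq (n : ℕ) : (16 : ℝ) ^ n = ((4 : ℝ) ^ n) ^ 2 := by
  rw [show (16 : ℝ) = 4 ^ 2 by norm_num, ← pow_mul, pow_mul']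

/-! ## §2 The slot `e`-family `msE (4^{n₀}) (pieceSize R U m)` against the grading -/

section E

variable {R : RenConsts} (hR : ∀ j, 0 ≤ R.Gfr j) (U : ℝ) (d m : ℕ)
include hR

/-- The certified high-part sizes are nonnegative. -/
theorem msE_pieceSize_nonneg (i : ℕ) : 0 ≤ msE d (pieceSize R U m) i := by
  have h := pieceSize_nonneg hR U m
  have := h 0; have := h 1; have := h 2; have := h 3; have := h 4; have := h (i - 4 + 4)
  rcases i with _ | _ | _ | _ | i
  · simp only [msE, anchorSize]; positivity
  · simp only [msE, anchorSize]; positivity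
  · simp only [msE, anchorSize]; positivity
  · simp only [msE, anchorSize]; positivity
  · simp only [msE, anchorSize]
    have := h (i + 4)
    have h4 : (i + 4 = 0) = False := by simp
    simp only [h4, if_false]
    positivity

omit hR in
/-- Order `0`, CONTRACTION form: `msE d a 0 ≤ 8·Gfr₀|U|/(4^m)²`. -/
theorem msE_pieceSize_zero_le_contraction : msE d (pieceSize R U m) 0 ≤ 8 * R.Gfr 0 * |U| / ((4 : ℝ) ^ m) ^ 2 := by
  have h : msE d (pieceSize R U m) 0 ≤ 4 * anchorSize (pieceSize R U m) 0 := min_le_left _ _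
  simp only [anchorSize, if_true] at h
  rw [pieceSize_zero_eq'] at h
  have : 4 * (2 * (R.Gfr 0 * |U| / ((4 : ℝ) ^ m) ^ 2)) = 8 * R.Gfr 0 * |U| / ((4 : ℝ) ^ m) ^ 2 := by ring
  linarith

omit hR in
/-- `2π⁶ ≤ 1923`. -/
theorem two_pi_pow_six_le : 2 * π ^ 6 ≤ 1923 := by
  have h := Real.pi_lt_d4
  have h0 := Real.pi_pos.le
  have h6 : π ^ 6 ≤ 3.1416 ^ 6 := pow_le_pow_left₀ h0 h.le 6
  nlinarith

/-- Order `0`, JACKSON form at `d = 4^{n₀}`: `msE (4^{n₀}) a 0 ≤ 1923·Gfr₁·U²/(4^m·4^{n₀})`. -/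
theorem msE_pieceSize_zero_le_jackson (n₀ : ℕ) :
    msE (4 ^ n₀) (pieceSize R U m) 0 ≤ 1923 * R.Gfr 1 * U ^ 2 / ((4 : ℝ) ^ m * (4 : ℝ) ^ n₀) := by
  have h : msE (4 ^ n₀) (pieceSize R U m) 0 ≤ 2 * π ^ 6 / ((4 ^ n₀ : ℕ) + 1) * anchorSize (pieceSize R U m) 1 :=
    (min_le_right _ _).trans (min_le_left _ _)
  simp only [anchorSize, one_ne_zero, if_false] at h
  rw [pieceSize_one_eq] at h
  have hx : (0 : ℝ) < 4 ^ m := by positivity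
  have hy : (0 : ℝ) < 4 ^ n₀ := by positivity
  have h1 := hR 1
  have hcast : (((4 ^ n₀ : ℕ) : ℝ)) = (4 : ℝ) ^ n₀ := by push_cast; ring
  rw [hcast] at h
  have hfrac : 2 * π ^ 6 / ((4 : ℝ) ^ n₀ + 1) ≤ 1923 / (4 : ℝ) ^ n₀ := by
    rw [div_le_div_iff₀ (by positivity) hy]
    nlinarith [two_pi_pow_six_le, Real.pi_pos]
  have hG : 0 ≤ R.Gfr 1 * U ^ 2 / (4 : ℝ) ^ m := by positivity
  calc msE (4 ^ n₀) (pieceSize R U m) 0 ≤ 2 * π ^ 6 / ((4 : ℝ) ^ n₀ + 1) * (R.Gfr 1 * U ^ 2 / (4 : ℝ) ^ m) := h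
    _ ≤ 1923 / (4 : ℝ) ^ n₀ * (R.Gfr 1 * U ^ 2 / (4 : ℝ) ^ m) := mul_le_mul_of_nonneg_right hfrac hG
    _ = 1923 * R.Gfr 1 * U ^ 2 / ((4 : ℝ) ^ m * (4 : ℝ) ^ n₀) := by field_simp

omit hR in
/-- Orders `1 … 4`, contraction form against the slot grading `η = 4Ḡ·U²/(4^m)²`, `λ = 2·4^m` (`Gfr_i ≤ Ḡ`):
`2ⁱ·msE d a i ≤ η·λⁱ`. -/
theorem two_pow_mul_msE_pieceSize_le {Gb : ℝ} (hGb : ∀ i, 1 ≤ i → i ≤ 4 → R.Gfr i ≤ Gb) {i : ℕ} (hi1 : 1 ≤ i) (hi4 : i ≤ 4) :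
    (2 : ℝ) ^ i * msE d (pieceSize R U m) i ≤ 4 * Gb * U ^ 2 / ((4 : ℝ) ^ m) ^ 2 * (2 * (4 : ℝ) ^ m) ^ i := by
  have hx : (0 : ℝ) < 4 ^ m := by positivity
  have hU2 : 0 ≤ U ^ 2 := sq_nonneg U
  have hG := hGb i hi1 hi4
  have hle : msE d (pieceSize R U m) i ≤ 4 * pieceSize R U m i := by
    interval_cases i
    · exact (min_le_left _ _).trans (by simp [anchorSize])
    · exact (min_le_left _ _).trans (by simp [anchorSize])
    · exact (min_le_left _ _).trans (by simp [anchorSize])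
    · exact le_of_eq (by simp [msE, anchorSize])
  have h2 : (0 : ℝ) ≤ 2 ^ i := by positivity
  refine (mul_le_mul_of_nonneg_left hle h2).trans ?_
  interval_cases i
  · rw [pieceSize_one_eq]
    rw [show (2 : ℝ) ^ 1 * (4 * (R.Gfr 1 * U ^ 2 / 4 ^ m)) = (R.Gfr 1 * U ^ 2) * (8 / 4 ^ m) by ring,
      show 4 * Gb * U ^ 2 / ((4 : ℝ) ^ m) ^ 2 * (2 * (4 : ℝ) ^ m) ^ 1 = (Gb * U ^ 2) * (8 / 4 ^ m) by field_simp; ring]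
    exact mul_le_mul_of_nonneg_right (mul_le_mul_of_nonneg_right hG hU2) (by positivity)
  · rw [pieceSize_two_eq]
    rw [show (2 : ℝ) ^ 2 * (4 * (R.Gfr 2 * U ^ 2)) = (R.Gfr 2 * U ^ 2) * 16 by ring,
      show 4 * Gb * U ^ 2 / ((4 : ℝ) ^ m) ^ 2 * (2 * (4 : ℝ) ^ m) ^ 2 = (Gb * U ^ 2) * 16 by field_simp; ring]
    exact mul_le_mul_of_nonneg_right (mul_le_mul_of_nonneg_right hG hU2) (by positivity)
  · rw [pieceSize_three_eq]
    rw [show (2 : ℝ) ^ 3 * (4 * (R.Gfr 3 * U ^ 2 * 4 ^ m)) = (R.Gfr 3 * U ^ 2) * (32 * 4 ^ m) by ring,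
      show 4 * Gb * U ^ 2 / ((4 : ℝ) ^ m) ^ 2 * (2 * (4 : ℝ) ^ m) ^ 3 = (Gb * U ^ 2) * (32 * 4 ^ m) by field_simp; ring]
    exact mul_le_mul_of_nonneg_right (mul_le_mul_of_nonneg_right hG hU2) (by positivity)
  · rw [pieceSize_four_eq]
    rw [show (2 : ℝ) ^ 4 * (4 * (R.Gfr 4 * U ^ 2 * ((4 : ℝ) ^ m) ^ 2)) = (R.Gfr 4 * U ^ 2) * (64 * ((4 : ℝ) ^ m) ^ 2) by ring,
      show 4 * Gb * U ^ 2 / ((4 : ℝ) ^ m) ^ 2 * (2 * (4 : ℝ) ^ m) ^ 4 = (Gb * U ^ 2) * (64 * ((4 : ℝ) ^ m) ^ 2) by field_simp; ring]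
    exact mul_le_mul_of_nonneg_right (mul_le_mul_of_nonneg_right hG hU2) (by positivity)

end E

/-! ## §3 The Λ-budgets against the graded shapes -/

/-- `msA3L R U n₀ (m − n₀) Λ₃ ≤ (4/3)Gfr₃U²·4^{n₀} + λ₃Gfr₁U²·4^{n₀} + (16/3)Gfr₃U²·4^m` for `Λ₃ ≤ λ₃·Gfr₁·U²·4^{n₀}`, `n₀ ≤ m`. -/
theorem msA3L_le_shape {R : RenConsts} {U Λ₃ lam3 : ℝ} {n₀ m : ℕ} (hm : n₀ ≤ m) (hΛ₃ : Λ₃ ≤ lam3 * R.Gfr 1 * U ^ 2 * (4 : ℝ) ^ n₀) :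
    msA3L R U n₀ (m - n₀) Λ₃ ≤ 4 / 3 * R.Gfr 3 * U ^ 2 * (4 : ℝ) ^ n₀ + lam3 * R.Gfr 1 * U ^ 2 * (4 : ℝ) ^ n₀ +
      16 / 3 * R.Gfr 3 * U ^ 2 * (4 : ℝ) ^ m := by
  unfold msA3L
  have e1 : (4 : ℝ) ^ (n₀ + 1) = 4 ^ n₀ * 4 := pow_succ _ _
  have e2 : (4 : ℝ) ^ (m + 1) = 4 ^ m * 4 := pow_succ _ _
  rw [show n₀ + (m - n₀) + 1 = m + 1 by omega, e1, e2]
  linarith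

/-- `msA4L R U n₀ (m − n₀) Λ₄ ≤ (16/15)Gfr₄U²·(4^{n₀})² + λ₄Gfr₁U²·(4^{n₀})² + (64/15)Gfr₄U²·(4^m)²` for `Λ₄ ≤ λ₄·Gfr₁·U²·(4^{n₀})²`. -/
theorem msA4L_le_shape {R : RenConsts} {U Λ₄ lam4 : ℝ} {n₀ m : ℕ} (hm : n₀ ≤ m) (hΛ₄ : Λ₄ ≤ lam4 * R.Gfr 1 * U ^ 2 * ((4 : ℝ) ^ n₀) ^ 2) :
    msA4L R U n₀ (m - n₀) Λ₄ ≤ 16 / 15 * R.Gfr 4 * U ^ 2 * ((4 : ℝ) ^ n₀) ^ 2 + lam4 * R.Gfr 1 * U ^ 2 * ((4 : ℝ) ^ n₀) ^ 2 +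
      64 / 15 * R.Gfr 4 * U ^ 2 * ((4 : ℝ) ^ m) ^ 2 := by
  unfold msA4L
  have e1 : (16 : ℝ) ^ (n₀ + 1) = ((4 : ℝ) ^ n₀) ^ 2 * 16 := by rw [pow_succ, sixteen_pow_eq_four_sq]
  have e2 : (16 : ℝ) ^ (m + 1) = ((4 : ℝ) ^ m) ^ 2 * 16 := by rw [pow_succ, sixteen_pow_eq_four_sq]
  rw [show n₀ + (m - n₀) + 1 = m + 1 by omega, e1, e2]
  linarith

/-- Nonnegativity of the Λ-budgets. -/
theorem msA3L_nonneg {R : RenConsts} (hR : ∀ j, 0 ≤ R.Gfr j) (U : ℝ) (n₀ k : ℕ) {Λ₃ : ℝ} (hΛ : 0 ≤ Λ₃) : 0 ≤ msA3L R U n₀ k Λ₃ := by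
  have := hR 3; unfold msA3L; positivity

/-- Nonnegativity of the Λ-budgets. -/
theorem msA4L_nonneg {R : RenConsts} (hR : ∀ j, 0 ≤ R.Gfr j) (U : ℝ) (n₀ k : ℕ) {Λ₄ : ℝ} (hΛ : 0 ≤ Λ₄) : 0 ≤ msA4L R U n₀ k Λ₄ := by
  have := hR 4; unfold msA4L; positivity

/-! ## §4 The `Q.CE`-keyed slot budget and the base budget in graded form (`U > 0`) -/

section Budget

variable (G : GeoConsts) (Q : EngConsts) (R : RenConsts) {U : ℝ} (hU : 0 < U) (n₀ m : ℕ)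
include hU

/-- `twoLegBar G Q U 1 n₀ = (S₁ + S′₁U)·U²/4^{n₀}`. -/
theorem twoLegBar_one_graded : twoLegBar G Q U 1 n₀ = (G.S 1 + Q.S' 1 * U) * U ^ 2 / (4 : ℝ) ^ n₀ := by
  unfold twoLegBar
  rw [abs_of_pos hU, uPow_succ, show (((1 : ℕ) : ℤ) - 2) * (n₀ : ℤ) = -((n₀ : ℕ) : ℤ) by push_cast; ring, zpow_neg, zpow_natCast]
  ring

/-- Slot budget, order `0`: `msBarQ … n₀ · pieceSize R U m 0 = CE(S₁+S′₁U)U²/4^{n₀}·(Gfr₀·U/(4^m)²)`. -/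
theorem msBarQ_mul_pieceSize_zero : msBarQ G Q U n₀ * (R.Gfr 0 * uPow 0 U * (4 : ℝ) ^ ((((0 : ℕ) : ℤ) - 2) * (m : ℤ))) =
    Q.CE * (G.S 1 + Q.S' 1 * U) * U ^ 2 / (4 : ℝ) ^ n₀ * (R.Gfr 0 * U / ((4 : ℝ) ^ m) ^ 2) := by
  have h := pieceSize_zero_eq' R U m
  unfold pieceSize at h
  unfold msBarQ
  rw [h, twoLegBar_one_graded G Q hU, abs_of_pos hU]
  ring

/-- Slot budget, order `1`. -/
theorem msBarQ_mul_pieceSize_one : msBarQ G Q U n₀ * (R.Gfr 1 * uPow 1 U * (4 : ℝ) ^ ((((1 : ℕ) : ℤ) - 2) * (m : ℤ))) =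
    Q.CE * (G.S 1 + Q.S' 1 * U) * U ^ 2 / (4 : ℝ) ^ n₀ * (R.Gfr 1 * U ^ 2 / (4 : ℝ) ^ m) := by
  have h := pieceSize_one_eq R U m
  unfold pieceSize at h
  unfold msBarQ
  rw [h, twoLegBar_one_graded G Q hU]
  ring

/-- Slot budget, order `2`. -/
theorem msBarQ_mul_pieceSize_two : msBarQ G Q U n₀ * (R.Gfr 2 * uPow 2 U * (4 : ℝ) ^ ((((2 : ℕ) : ℤ) - 2) * (m : ℤ))) =
    Q.CE * (G.S 1 + Q.S' 1 * U) * U ^ 2 / (4 : ℝ) ^ n₀ * (R.Gfr 2 * U ^ 2) := by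
  have h := pieceSize_two_eq R U m
  unfold pieceSize at h
  unfold msBarQ
  rw [h, twoLegBar_one_graded G Q hU]
  ring

/-- Slot budget, order `3`. -/
theorem msBarQ_mul_pieceSize_three : msBarQ G Q U n₀ * (R.Gfr 3 * uPow 3 U * (4 : ℝ) ^ ((((3 : ℕ) : ℤ) - 2) * (m : ℤ))) =
    Q.CE * (G.S 1 + Q.S' 1 * U) * U ^ 2 / (4 : ℝ) ^ n₀ * (R.Gfr 3 * U ^ 2 * (4 : ℝ) ^ m) := by
  have h := pieceSize_three_eq R U m
  unfold pieceSize at h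
  unfold msBarQ
  rw [h, twoLegBar_one_graded G Q hU]
  ring

/-- Slot budget, order `4`. -/
theorem msBarQ_mul_pieceSize_four : msBarQ G Q U n₀ * (R.Gfr 4 * uPow 4 U * (4 : ℝ) ^ ((((4 : ℕ) : ℤ) - 2) * (m : ℤ))) =
    Q.CE * (G.S 1 + Q.S' 1 * U) * U ^ 2 / (4 : ℝ) ^ n₀ * (R.Gfr 4 * U ^ 2 * ((4 : ℝ) ^ m) ^ 2) := by
  have h := pieceSize_four_eq R U m
  unfold pieceSize at h
  unfold msBarQ
  rw [h, twoLegBar_one_graded G Q hU]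
  ring

/-- Base budget, graded: `twoLegBar G Q U j n₀` for `j = 0 … 4`. -/
theorem twoLegBar_graded :
    twoLegBar G Q U 0 n₀ = (G.S 0 + Q.S' 0 * U) * U / ((4 : ℝ) ^ n₀) ^ 2 ∧
    twoLegBar G Q U 1 n₀ = (G.S 1 + Q.S' 1 * U) * U ^ 2 / (4 : ℝ) ^ n₀ ∧
    twoLegBar G Q U 2 n₀ = (G.S 2 + Q.S' 2 * U) * U ^ 2 ∧
    twoLegBar G Q U 3 n₀ = (G.S 3 + Q.S' 3 * U) * U ^ 2 * (4 : ℝ) ^ n₀ ∧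
    twoLegBar G Q U 4 n₀ = (G.S 4 + Q.S' 4 * U) * U ^ 2 * ((4 : ℝ) ^ n₀) ^ 2 := by
  unfold twoLegBar
  rw [abs_of_pos hU]
  refine ⟨?_, ?_, ?_, ?_, ?_⟩
  · rw [uPow_zero, abs_of_pos hU, show (((0 : ℕ) : ℤ) - 2) * (n₀ : ℤ) = -((2 * n₀ : ℕ) : ℤ) by push_cast; ring, zpow_neg, zpow_natCast,
      pow_mul']; ring
  · rw [uPow_succ, show (((1 : ℕ) : ℤ) - 2) * (n₀ : ℤ) = -((n₀ : ℕ) : ℤ) by push_cast; ring, zpow_neg, zpow_natCast]; ring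
  · rw [uPow_succ, show (((2 : ℕ) : ℤ) - 2) * (n₀ : ℤ) = 0 by push_cast; ring, zpow_zero]; ring
  · rw [uPow_succ, show (((3 : ℕ) : ℤ) - 2) * (n₀ : ℤ) = ((n₀ : ℕ) : ℤ) by push_cast; ring, zpow_natCast]
  · rw [uPow_succ, show (((4 : ℕ) : ℤ) - 2) * (n₀ : ℤ) = ((2 * n₀ : ℕ) : ℤ) by push_cast; ring, zpow_natCast, pow_mul']

end Budget

end Summit.HubbardSuperconductivity.HubbardSuperconductivity.Theorems.KLRegimeSplit

end
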